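import Summits.HodgeConjecture.HodgeConjecture.Theorems.HeckePrymWeilHeckePrymAnchorsOfTwoFacts
import Literature.AlgebraicGeometry.HodgeTheory.InvariantClassesFromTotalSpaceHolds
import Literature.AlgebraicGeometry.HodgeTheory.WeilFamilyGlobalAction
import HarnessLib

/-!
# `HeckePrymAnchors` modulo ONE named fact: Deligne's abelian scheme with `K`-action (item stmt-HodgeConjecture-14496, route HeckePrymWeil)

Line `Sketch`, v14 (continuation lead c9): the crux `HeckePrymAnchors` of route `HeckePrymWeil`
derived from the single named fact registered as the stub of the line's skeleton
(`Cruxes/HeckePrymAnchors/Lines/Sketch.lean`: `stub_weilFamilyCore`):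

* `HodgeTheory.deligne1982_weilFamily_globalAction` (`HodgeTheory/WeilFamilyGlobalAction`;
  [Deligne1982HodgeCycles], proof of Thm. 4.8, p. 48, clauses (a)–(c), and p. 50: the abelian
  scheme with `E`-action through `X`, all fibres of balanced Weil type, a CM/tensor fibre, and the
  flatness of the Weil class).

The G side of the earlier two-fact closures (`heckePrymAnchors_of_two_facts`, p107536:
`deligne1968_invariantClass_fromTotalSpace → deligne1982_weilFamily_hodgeWeilSection →
HeckePrymAnchors`) is now DISCHARGED in the tree by
`deligne1968_invariantClass_fromTotalSpace_holds` (`HodgeTheory/InvariantClassesFromTotalSpaceHolds`,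
p117333: Voisin II Thm. 4.18 for smooth projective families immersed in `ℙᵐ`), and M' implies F4'
by the tree's theorem `deligne1982_weilFamily_hodgeWeilSection_of_globalAction` (p118411). The proof
is the composition. No `sorry`, no definition, no new axiom.
-/

noncomputable section

-- every declaration of this problem lives in `Summit.HodgeConjecture.HodgeConjecture.…` (summit = sub-problem)
set_option linter.dupNamespace false

open CategoryTheory AlgebraicGeometry Limits MonoidalCategory CartesianMonoidalCategory

namespace Summit.HodgeConjecture.HodgeConjecture.Theorems.HeckePrymWeilLine

open Literature.AlgebraicGeometry Literature.AlgebraicGeometry.Motives Literature.AlgebraicGeometry.HodgeTheory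
open Summit.HodgeConjecture.HodgeConjecture.Theses.HeckePrymWeil

/-- **`HeckePrymAnchors` from Deligne's abelian scheme with `K`-action alone.** The crux of route
`HeckePrymWeil` follows from the one named fact `HodgeTheory.deligne1982_weilFamily_globalAction`:
it gives the fibrewise-Hodge flat Weil section package
(`deligne1982_weilFamily_hodgeWeilSection_of_globalAction`), the invariant cycle theorem is the
tree's `deligne1968_invariantClass_fromTotalSpace_holds`, and the landed closure
`heckePrymAnchors_of_two_facts` concludes.
[cite: Deligne1982HodgeCycles, proof of Thm. 4.8 (pp. 47–52) with Prop. 4.4]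
[cite: VoisinHodgeII2003, Thm. 4.18 (with Thm. 4.15, Lemma 4.17)] -/
theorem heckePrymAnchors_of_globalAction :
    (deligne1982_weilFamily_globalAction) → Summit.HodgeConjecture.HodgeConjecture.Theses.HeckePrymWeil.HeckePrymAnchors :=
  fun hGA =>
    heckePrymAnchors_of_two_facts deligne1968_invariantClass_fromTotalSpace_holds
      (deligne1982_weilFamily_hodgeWeilSection_of_globalAction hGA)

end Summit.HodgeConjecture.HodgeConjecture.Theorems.HeckePrymWeilLine

end
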